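import Summits.QuantumFields.YangMills.Theorems.VirialFluxGapRingFrameHessian
import HarnessLib

/-!
# Route `VirialFluxGap` (YangMills): BLOCK FRAME CALCULUS — frame derivatives of functions of finitely many coordinates, and UNIFORM
# (L-independent) bounds for their iterated frame derivatives (toward the polynomial derivative bounds of the resolvent Euler field)

Toward the deciding crux `VirialFluxGap.PeriodicSoftness` (item stmt-QuantumFields-24141), generic-region Euler field (memo
`fcl-p3-g40-RESOLVENT-EULER-FIELD-24141.md`).  The pointwise package ✓`FrameHessian.pointwise_taylor_package` needs sup bounds `K₁, K₂, K₃`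
on THIRD frame derivatives of the deficit polynomial `ringPoly`, polynomial in `L`.  Every one of the `12L⁴` terms of `ringPoly` is a FIXED
smooth function `φ` of `k ≤ 4` coordinates, `φ ∘ π_v` with `π_v M = (M_{v_1}, …, M_{v_k})`; this file proves that frame derivatives pass
through such projections and that the iterated block derivatives of a fixed `φ` are bounded on unitary arguments by an ABSOLUTE constant:

* §1 the block tangent map `mulTangentK Yk A = (A_i·Yk_i)_i` on `(M₂(ℂ))^k`, the block frame derivative `frameDK Yk φ A = Dφ(A)[A·Yk]`,
  smoothness, linearity in the direction and in the function;
* §2 the coordinate projection `projK v : ((Fin (2 * L - 1 + 1) → Edge 3 L → Matrix (Fin 2) (Fin 2) ℂ) × (Site 3 L → Matrix (Fin 2) (Fin 2) ℂ)) → (M₂)^k` (a continuous linear map), `projK v (mulTangent Y M) = mulTangentK (Y ∘ v) (projK v M)`,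
  ★★ `frameD_comp_projK` — `frameD Y (φ ∘ projK v) = (frameDK (Y∘v) φ) ∘ projK v`, iterated to third order (`frameD3_comp_projK`);
* §3 ★★ `exists_bound_frameDK3` — for a fixed smooth `φ : (M₂)^k → ℝ` there is `C` with
  `|frameDK Y¹ (frameDK Y² (frameDK Y³ φ)) A| ≤ C·b₁b₂b₃` for all `A` with every `A_i ∈ SU(2)` and all block directions with `‖Yⁱ_j‖ ≤ bᵢ`
  (real-basis expansion of the directions — trilinearity — and compactness of `SU(2)^k`; the constant is NOT explicit but independent of
  everything else, in particular of `L`).  (Only the third-order bound is proved here; lower orders are not needed by the consumer.)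

HONEST FRAMING: calculus bookkeeping; the application to `ringPoly` (term decomposition, the count `12L⁴`) is the companion file; ⟨24141⟩ stays
OPEN; no stub / crux / rung / summit is closed; the Yang–Mills mass gap is NOT proved; no summit is proved by a line.  Definitions
(`mulTangentK`, `frameDK`, `coordAt`, `projK`, `blockBasis`, `blockCoord`) are problem-side plumbing (no `Prop`); 0 `sorry`, standard axioms.
Explicit-unit seat `ym-line-fcl-p3` g40 (cell ym-idea-1, free hands), `--supports stmt-QuantumFields-24141`.  References: [folklore].
-/

set_option autoImplicit false

noncomputable section

open scoped Matrix BigOperators ContDiff Topology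
open MeasureTheory Set
open Literature.MathematicalPhysics.QuantumFieldTheory hiding SU2
open Literature.MathematicalPhysics.QuantumLattice
open Literature.MathematicalPhysics.QuantumFieldTheory.SUNBakryEmery (expSU coe_expSU matTop)

namespace Summit.QuantumFields.YangMills.Theorems.VirialFluxGap.FrameHessian

open Summit.QuantumFields.YangMills.Theorems.FemtoTransferGap
open Summit.QuantumFields.YangMills.Theorems.FemtoTransferGap.TT
open Summit.QuantumFields.YangMills.Theorems.VirialFluxGap.RingDeficit
open Summit.QuantumFields.YangMills.Theorems.VirialFluxGap.FrameDerivative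

/-- `SU(2)^k` is compact (stated before the Frobenius topology is installed; the topologies agree definitionally). [folklore] -/
theorem compactSpace_blocksSU2 (k : ℕ) : CompactSpace (Fin k → SU2) := by
  infer_instance

open scoped Matrix.Norms.Frobenius

attribute [local instance 2000] Literature.MathematicalPhysics.QuantumFieldTheory.SUNBakryEmery.matTop

/-! ## §1 Block tangent map and block frame derivative on `(M₂(ℂ))^k` -/

/-- The block tangent map: `(A_i) ↦ (A_i · Yk_i)`. [folklore] -/
def mulTangentK {k : ℕ} (Yk : Fin k → Matrix (Fin 2) (Fin 2) ℂ) (A : Fin k → Matrix (Fin 2) (Fin 2) ℂ) :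
    Fin k → Matrix (Fin 2) (Fin 2) ℂ :=
  fun i => A i * Yk i

/-- The block frame derivative `frameDK Yk φ A = Dφ(A)[(A_i·Yk_i)_i]`. [folklore] -/
def frameDK {k : ℕ} (Yk : Fin k → Matrix (Fin 2) (Fin 2) ℂ) (φ : (Fin k → Matrix (Fin 2) (Fin 2) ℂ) → ℝ)
    (A : Fin k → Matrix (Fin 2) (Fin 2) ℂ) : ℝ :=
  fderiv ℝ φ A (mulTangentK Yk A)

/-- The block tangent map as a continuous linear map of the point. [folklore] -/
theorem mulTangentK_isLinear {k : ℕ} (Yk : Fin k → Matrix (Fin 2) (Fin 2) ℂ) :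
    ∃ T : (Fin k → Matrix (Fin 2) (Fin 2) ℂ) →L[ℝ] (Fin k → Matrix (Fin 2) (Fin 2) ℂ), ∀ A, T A = mulTangentK Yk A := by
  have hcont : Continuous (mulTangentK Yk) := by
    unfold mulTangentK
    exact continuous_pi fun i => (continuous_apply i).mul continuous_const
  let T : (Fin k → Matrix (Fin 2) (Fin 2) ℂ) →L[ℝ] (Fin k → Matrix (Fin 2) (Fin 2) ℂ) :=
    { toFun := mulTangentK Yk
      map_add' := fun A B => by unfold mulTangentK; funext i; simp only [Pi.add_apply, Matrix.add_mul]
      map_smul' := fun r A => by unfold mulTangentK; funext i; simp only [Pi.smul_apply, Matrix.smul_mul, RingHom.id_apply]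
      cont := hcont }
  exact ⟨T, fun A => rfl⟩

/-- Block frame derivatives of smooth functions are smooth. [folklore] -/
theorem contDiff_frameDK {k : ℕ} {φ : (Fin k → Matrix (Fin 2) (Fin 2) ℂ) → ℝ} (hφ : ContDiff ℝ ∞ φ)
    (Yk : Fin k → Matrix (Fin 2) (Fin 2) ℂ) : ContDiff ℝ ∞ (frameDK Yk φ) := by
  obtain ⟨T, hT⟩ := mulTangentK_isLinear Yk
  have h1 : ContDiff ℝ ∞ (fderiv ℝ φ) := hφ.fderiv_right (m := ∞) le_rfl
  have h2 : ContDiff ℝ ∞ fun A : Fin k → Matrix (Fin 2) (Fin 2) ℂ => T A := T.contDiff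
  have heq : frameDK Yk φ = fun A => (fderiv ℝ φ A) (T A) := funext fun A => by rw [frameDK, hT]
  rw [heq]
  exact h1.clm_apply h2

/-- The block frame derivative is additive in the direction. [folklore] -/
theorem frameDK_add_dir {k : ℕ} (Yk Zk : Fin k → Matrix (Fin 2) (Fin 2) ℂ) (φ : (Fin k → Matrix (Fin 2) (Fin 2) ℂ) → ℝ)
    (A : Fin k → Matrix (Fin 2) (Fin 2) ℂ) : frameDK (Yk + Zk) φ A = frameDK Yk φ A + frameDK Zk φ A := by
  have h : mulTangentK (Yk + Zk) A = mulTangentK Yk A + mulTangentK Zk A := by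
    unfold mulTangentK; funext i; simp only [Pi.add_apply, Matrix.mul_add]
  rw [frameDK, frameDK, frameDK, h, map_add]

/-- The block frame derivative is homogeneous in the direction. [folklore] -/
theorem frameDK_smul_dir {k : ℕ} (r : ℝ) (Yk : Fin k → Matrix (Fin 2) (Fin 2) ℂ) (φ : (Fin k → Matrix (Fin 2) (Fin 2) ℂ) → ℝ)
    (A : Fin k → Matrix (Fin 2) (Fin 2) ℂ) : frameDK (r • Yk) φ A = r * frameDK Yk φ A := by
  have h : mulTangentK (r • Yk) A = r • mulTangentK Yk A := by
    unfold mulTangentK; funext i; simp only [Pi.smul_apply, Matrix.mul_smul]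
  rw [frameDK, frameDK, h, map_smul, smul_eq_mul]

/-- The block frame derivative along a finite linear combination of directions. [folklore] -/
theorem frameDK_sum_smul_dir {k : ℕ} {β : Type*} (s : Finset β) (c : β → ℝ) (E : β → Fin k → Matrix (Fin 2) (Fin 2) ℂ)
    (φ : (Fin k → Matrix (Fin 2) (Fin 2) ℂ) → ℝ) (A : Fin k → Matrix (Fin 2) (Fin 2) ℂ) :
    frameDK (∑ b ∈ s, c b • E b) φ A = ∑ b ∈ s, c b * frameDK (E b) φ A := by
  classical
  induction s using Finset.induction_on with
  | empty =>
    simp only [Finset.sum_empty]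
    have : mulTangentK (0 : Fin k → Matrix (Fin 2) (Fin 2) ℂ) A = 0 := by
      unfold mulTangentK; funext i; simp
    rw [frameDK, this, map_zero]
  | insert a s ha ih => rw [Finset.sum_insert ha, Finset.sum_insert ha, frameDK_add_dir, frameDK_smul_dir, ih]

/-- Linearity of the block frame derivative in the FUNCTION (finite linear combinations of smooth functions). [folklore] -/
theorem frameDK_fun_sum {k : ℕ} {β : Type*} [Fintype β] (Yk : Fin k → Matrix (Fin 2) (Fin 2) ℂ) (c : β → ℝ)
    {h : β → (Fin k → Matrix (Fin 2) (Fin 2) ℂ) → ℝ} (hh : ∀ b, ContDiff ℝ ∞ (h b)) (A : Fin k → Matrix (Fin 2) (Fin 2) ℂ) :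
    frameDK Yk (fun A' => ∑ b, c b * h b A') A = ∑ b, c b * frameDK Yk (h b) A := by
  have hd : ∀ b, HasFDerivAt (fun A' => c b * h b A') (c b • fderiv ℝ (h b) A) A := fun b =>
    (((hh b).differentiable (by simp) A).hasFDerivAt).const_mul (c b)
  have hs : HasFDerivAt (fun A' => ∑ b, c b * h b A') (∑ b, c b • fderiv ℝ (h b) A) A :=
    HasFDerivAt.fun_sum fun b _ => hd b
  rw [frameDK, hs.fderiv, FunLike.coe_sum, Finset.sum_apply]
  refine Finset.sum_congr rfl fun b _ => ?_
  rw [FunLike.coe_smul, Pi.smul_apply, smul_eq_mul, frameDK]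

/-- The fully multilinear expansion of a THIRD iterated block derivative along finite linear combinations of directions. [folklore] -/
theorem frameDK3_sum_smul {k : ℕ} {β : Type*} [Fintype β] (E : β → Fin k → Matrix (Fin 2) (Fin 2) ℂ)
    (c₁ c₂ c₃ : β → ℝ) {φ : (Fin k → Matrix (Fin 2) (Fin 2) ℂ) → ℝ} (hφ : ContDiff ℝ ∞ φ) (A : Fin k → Matrix (Fin 2) (Fin 2) ℂ) :
    frameDK (∑ b, c₁ b • E b) (frameDK (∑ b, c₂ b • E b) (frameDK (∑ b, c₃ b • E b) φ)) A =
      ∑ b₁, ∑ b₂, ∑ b₃, c₁ b₁ * (c₂ b₂ * (c₃ b₃ * frameDK (E b₁) (frameDK (E b₂) (frameDK (E b₃) φ)) A)) := by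
  -- innermost: `frameDK (Σ c₃ E) φ = Σ c₃ · frameDK E φ` as functions
  have h3 : frameDK (∑ b, c₃ b • E b) φ = fun A' => ∑ b, c₃ b * frameDK (E b) φ A' :=
    funext fun A' => frameDK_sum_smul_dir Finset.univ c₃ E φ A'
  have h3s : ∀ b, ContDiff ℝ ∞ (frameDK (E b) φ) := fun b => contDiff_frameDK hφ (E b)
  -- middle
  have h2 : frameDK (∑ b, c₂ b • E b) (frameDK (∑ b, c₃ b • E b) φ) =
      fun A' => ∑ b₂, c₂ b₂ * ∑ b₃, c₃ b₃ * frameDK (E b₂) (frameDK (E b₃) φ) A' := by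
    funext A'
    rw [h3, frameDK_sum_smul_dir]
    refine Finset.sum_congr rfl fun b₂ _ => ?_
    rw [frameDK_fun_sum (E b₂) c₃ h3s A']
  have h2s : ∀ b₂ b₃, ContDiff ℝ ∞ (frameDK (E b₂) (frameDK (E b₃) φ)) := fun b₂ b₃ => contDiff_frameDK (h3s b₃) (E b₂)
  have h2' : frameDK (∑ b, c₂ b • E b) (frameDK (∑ b, c₃ b • E b) φ) =
      fun A' => ∑ p : β × β, (c₂ p.1 * c₃ p.2) * frameDK (E p.1) (frameDK (E p.2) φ) A' := by
    rw [h2]; funext A'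
    rw [Fintype.sum_prod_type]
    refine Finset.sum_congr rfl fun b₂ _ => ?_
    rw [Finset.mul_sum]
    refine Finset.sum_congr rfl fun b₃ _ => by ring
  rw [h2', frameDK_sum_smul_dir]
  have hps : ∀ p : β × β, ContDiff ℝ ∞ (frameDK (E p.1) (frameDK (E p.2) φ)) := fun p => h2s p.1 p.2
  refine Finset.sum_congr rfl fun b₁ _ => ?_
  rw [frameDK_fun_sum (E b₁) (fun p : β × β => c₂ p.1 * c₃ p.2) hps A, Fintype.sum_prod_type, Finset.mul_sum]
  refine Finset.sum_congr rfl fun b₂ _ => ?_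
  simp only [Finset.mul_sum]
  refine Finset.sum_congr rfl fun b₃ _ => by ring

/-! ## §2 Functions of finitely many coordinates -/

variable {L : ℕ} [NeZero L]

omit [NeZero L] in
/-- The coordinate of the ambient point at a variable (slice link or seam site). [folklore] -/
def coordAt (w : ((Fin (2 * L - 1 + 1) × Edge 3 L) ⊕ Site 3 L)) (M : ((Fin (2 * L - 1 + 1) → Edge 3 L → Matrix (Fin 2) (Fin 2) ℂ) × (Site 3 L → Matrix (Fin 2) (Fin 2) ℂ))) : Matrix (Fin 2) (Fin 2) ℂ :=
  match w with
  | Sum.inl ie => M.1 ie.1 ie.2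
  | Sum.inr x => M.2 x

omit [NeZero L] in
/-- The projection onto `k` coordinates `v_1, …, v_k`. [folklore] -/
def projK {k : ℕ} (v : Fin k → ((Fin (2 * L - 1 + 1) × Edge 3 L) ⊕ Site 3 L)) (M : ((Fin (2 * L - 1 + 1) → Edge 3 L → Matrix (Fin 2) (Fin 2) ℂ) × (Site 3 L → Matrix (Fin 2) (Fin 2) ℂ))) : Fin k → Matrix (Fin 2) (Fin 2) ℂ :=
  fun i => coordAt (v i) M

omit [NeZero L] in
/-- The projection intertwines the tangent maps: `projK v (mulTangent Y M) = mulTangentK (Y ∘ v) (projK v M)`. [folklore] -/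
theorem projK_mulTangent {k : ℕ} (v : Fin k → ((Fin (2 * L - 1 + 1) × Edge 3 L) ⊕ Site 3 L)) (Y : ((Fin (2 * L - 1 + 1) × Edge 3 L) ⊕ Site 3 L) → Matrix (Fin 2) (Fin 2) ℂ) (M : ((Fin (2 * L - 1 + 1) → Edge 3 L → Matrix (Fin 2) (Fin 2) ℂ) × (Site 3 L → Matrix (Fin 2) (Fin 2) ℂ))) :
    projK v (mulTangent Y M) = mulTangentK (fun i => Y (v i)) (projK v M) := by
  funext i
  simp only [projK, mulTangentK]
  unfold coordAt mulTangent
  generalize v i = w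
  rcases w with ⟨i', e'⟩ | x <;> rfl

omit [NeZero L] in
/-- The coordinate projection is a continuous linear map. [folklore] -/
theorem projK_isLinear {k : ℕ} (v : Fin k → ((Fin (2 * L - 1 + 1) × Edge 3 L) ⊕ Site 3 L)) : ∃ T : ((Fin (2 * L - 1 + 1) → Edge 3 L → Matrix (Fin 2) (Fin 2) ℂ) × (Site 3 L → Matrix (Fin 2) (Fin 2) ℂ)) →L[ℝ] (Fin k → Matrix (Fin 2) (Fin 2) ℂ), ∀ M, T M = projK v M := by
  have hc : ∀ w : ((Fin (2 * L - 1 + 1) × Edge 3 L) ⊕ Site 3 L), Continuous (fun M : ((Fin (2 * L - 1 + 1) → Edge 3 L → Matrix (Fin 2) (Fin 2) ℂ) × (Site 3 L → Matrix (Fin 2) (Fin 2) ℂ)) => coordAt w M) := by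
    intro w
    rcases w with ⟨i, e⟩ | x
    · have h1 : Continuous (fun M : ((Fin (2 * L - 1 + 1) → Edge 3 L → Matrix (Fin 2) (Fin 2) ℂ) × (Site 3 L → Matrix (Fin 2) (Fin 2) ℂ)) => M.1) := continuous_fst
      have h2 : Continuous (fun N : Fin (2 * L - 1 + 1) → Edge 3 L → Matrix (Fin 2) (Fin 2) ℂ => N i) := continuous_apply i
      have h3 : Continuous (fun N : Edge 3 L → Matrix (Fin 2) (Fin 2) ℂ => N e) := continuous_apply e
      exact h3.comp (h2.comp h1)
    · have h1 : Continuous (fun M : ((Fin (2 * L - 1 + 1) → Edge 3 L → Matrix (Fin 2) (Fin 2) ℂ) × (Site 3 L → Matrix (Fin 2) (Fin 2) ℂ)) => M.2) := continuous_snd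
      have h3 : Continuous (fun N : Site 3 L → Matrix (Fin 2) (Fin 2) ℂ => N x) := continuous_apply x
      exact h3.comp h1
  have hadd : ∀ w (M M' : ((Fin (2 * L - 1 + 1) → Edge 3 L → Matrix (Fin 2) (Fin 2) ℂ) × (Site 3 L → Matrix (Fin 2) (Fin 2) ℂ))), coordAt w (M + M') = coordAt w M + coordAt w M' := by
    intro w M M'; rcases w with ⟨i, e⟩ | x <;> rfl
  have hsmul : ∀ w (r : ℝ) (M : ((Fin (2 * L - 1 + 1) → Edge 3 L → Matrix (Fin 2) (Fin 2) ℂ) × (Site 3 L → Matrix (Fin 2) (Fin 2) ℂ))), coordAt w (r • M) = r • coordAt w M := by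
    intro w r M; rcases w with ⟨i, e⟩ | x <;> rfl
  let T : ((Fin (2 * L - 1 + 1) → Edge 3 L → Matrix (Fin 2) (Fin 2) ℂ) × (Site 3 L → Matrix (Fin 2) (Fin 2) ℂ)) →L[ℝ] (Fin k → Matrix (Fin 2) (Fin 2) ℂ) :=
    { toFun := projK v
      map_add' := fun M M' => by unfold projK; funext i; rw [Pi.add_apply, hadd]
      map_smul' := fun r M => by unfold projK; funext i; rw [Pi.smul_apply, RingHom.id_apply, hsmul]
      cont := continuous_pi fun i => hc (v i) }
  exact ⟨T, fun M => rfl⟩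

/-- Functions of finitely many coordinates are smooth when the block function is. [folklore] -/
theorem contDiff_comp_projK {k : ℕ} {φ : (Fin k → Matrix (Fin 2) (Fin 2) ℂ) → ℝ} (hφ : ContDiff ℝ ∞ φ) (v : Fin k → ((Fin (2 * L - 1 + 1) × Edge 3 L) ⊕ Site 3 L)) :
    ContDiff ℝ ∞ (fun M : ((Fin (2 * L - 1 + 1) → Edge 3 L → Matrix (Fin 2) (Fin 2) ℂ) × (Site 3 L → Matrix (Fin 2) (Fin 2) ℂ)) => φ (projK v M)) := by
  obtain ⟨T, hT⟩ := projK_isLinear (L := L) v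
  have : (fun M : ((Fin (2 * L - 1 + 1) → Edge 3 L → Matrix (Fin 2) (Fin 2) ℂ) × (Site 3 L → Matrix (Fin 2) (Fin 2) ℂ)) => φ (projK v M)) = fun M => φ (T M) := funext fun M => by rw [hT]
  rw [this]
  exact hφ.comp T.contDiff

/-- ★★ **Frame derivatives pass through coordinate projections**: `frameD Y (φ ∘ projK v) M = frameDK (Y ∘ v) φ (projK v M)`. [folklore] -/
theorem frameD_comp_projK {k : ℕ} {φ : (Fin k → Matrix (Fin 2) (Fin 2) ℂ) → ℝ} (hφ : ContDiff ℝ ∞ φ) (v : Fin k → ((Fin (2 * L - 1 + 1) × Edge 3 L) ⊕ Site 3 L))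
    (Y : ((Fin (2 * L - 1 + 1) × Edge 3 L) ⊕ Site 3 L) → Matrix (Fin 2) (Fin 2) ℂ) (M : ((Fin (2 * L - 1 + 1) → Edge 3 L → Matrix (Fin 2) (Fin 2) ℂ) × (Site 3 L → Matrix (Fin 2) (Fin 2) ℂ))) :
    frameD Y (fun M' : ((Fin (2 * L - 1 + 1) → Edge 3 L → Matrix (Fin 2) (Fin 2) ℂ) × (Site 3 L → Matrix (Fin 2) (Fin 2) ℂ)) => φ (projK v M')) M = frameDK (fun i => Y (v i)) φ (projK v M) := by
  obtain ⟨T, hT⟩ := projK_isLinear (L := L) v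
  have heq : (fun M' : ((Fin (2 * L - 1 + 1) → Edge 3 L → Matrix (Fin 2) (Fin 2) ℂ) × (Site 3 L → Matrix (Fin 2) (Fin 2) ℂ)) => φ (projK v M')) = fun M' => φ (T M') := funext fun M' => by rw [hT]
  have hd : HasFDerivAt (fun M' : ((Fin (2 * L - 1 + 1) → Edge 3 L → Matrix (Fin 2) (Fin 2) ℂ) × (Site 3 L → Matrix (Fin 2) (Fin 2) ℂ)) => φ (T M')) ((fderiv ℝ φ (T M)).comp T) M :=
    ((hφ.differentiable (by simp) (T M)).hasFDerivAt).comp M T.hasFDerivAt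
  rw [frameD, heq, hd.fderiv, ContinuousLinearMap.comp_apply, hT, hT, projK_mulTangent, frameDK]

/-- ★ Third-order version: `∂_{Y¹}∂_{Y²}∂_{Y³}(φ ∘ projK v) = (∂^K_{Y¹∘v}∂^K_{Y²∘v}∂^K_{Y³∘v} φ) ∘ projK v`. [folklore] -/
theorem frameD3_comp_projK {k : ℕ} {φ : (Fin k → Matrix (Fin 2) (Fin 2) ℂ) → ℝ} (hφ : ContDiff ℝ ∞ φ) (v : Fin k → ((Fin (2 * L - 1 + 1) × Edge 3 L) ⊕ Site 3 L))
    (Y₁ Y₂ Y₃ : ((Fin (2 * L - 1 + 1) × Edge 3 L) ⊕ Site 3 L) → Matrix (Fin 2) (Fin 2) ℂ) (M : ((Fin (2 * L - 1 + 1) → Edge 3 L → Matrix (Fin 2) (Fin 2) ℂ) × (Site 3 L → Matrix (Fin 2) (Fin 2) ℂ))) :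
    frameD Y₁ (frameD Y₂ (frameD Y₃ (fun M' : ((Fin (2 * L - 1 + 1) → Edge 3 L → Matrix (Fin 2) (Fin 2) ℂ) × (Site 3 L → Matrix (Fin 2) (Fin 2) ℂ)) => φ (projK v M')))) M =
      frameDK (fun i => Y₁ (v i)) (frameDK (fun i => Y₂ (v i)) (frameDK (fun i => Y₃ (v i)) φ)) (projK v M) := by
  have e3 : frameD Y₃ (fun M' : ((Fin (2 * L - 1 + 1) → Edge 3 L → Matrix (Fin 2) (Fin 2) ℂ) × (Site 3 L → Matrix (Fin 2) (Fin 2) ℂ)) => φ (projK v M')) = fun M' => (frameDK (fun i => Y₃ (v i)) φ) (projK v M') :=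
    funext fun M' => frameD_comp_projK hφ v Y₃ M'
  have hφ3 := contDiff_frameDK hφ (fun i => Y₃ (v i))
  have e2 : frameD Y₂ (frameD Y₃ (fun M' : ((Fin (2 * L - 1 + 1) → Edge 3 L → Matrix (Fin 2) (Fin 2) ℂ) × (Site 3 L → Matrix (Fin 2) (Fin 2) ℂ)) => φ (projK v M'))) =
      fun M' => (frameDK (fun i => Y₂ (v i)) (frameDK (fun i => Y₃ (v i)) φ)) (projK v M') := by
    rw [e3]; funext M'; exact frameD_comp_projK hφ3 v Y₂ M'
  have hφ2 := contDiff_frameDK hφ3 (fun i => Y₂ (v i))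
  rw [e2]
  exact frameD_comp_projK hφ2 v Y₁ M

/-! ## §3 Uniform bounds for iterated block derivatives of a fixed block function -/

/-- The real basis of the block space: single entries `1` or `I` at one slot. [folklore] -/
def blockBasis (k : ℕ) (b : Fin k × Fin 2 × Fin 2 × Bool) : Fin k → Matrix (Fin 2) (Fin 2) ℂ :=
  Pi.single b.1 (Matrix.single b.2.1 b.2.2.1 (if b.2.2.2 then Complex.I else 1))

/-- The real coordinates of a block direction in that basis: real and imaginary parts of the entries. [folklore] -/
def blockCoord (k : ℕ) (Yk : Fin k → Matrix (Fin 2) (Fin 2) ℂ) (b : Fin k × Fin 2 × Fin 2 × Bool) : ℝ :=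
  if b.2.2.2 then (Yk b.1 b.2.1 b.2.2.1).im else (Yk b.1 b.2.1 b.2.2.1).re

/-- Every block direction is the real combination of the basis with its coordinates. [folklore] -/
theorem blockBasis_expand (k : ℕ) (Yk : Fin k → Matrix (Fin 2) (Fin 2) ℂ) :
    Yk = ∑ b, blockCoord k Yk b • blockBasis k b := by
  classical
  funext i
  ext m n
  rw [Finset.sum_apply, Matrix.sum_apply]
  have hkey : ∀ b : Fin k × Fin 2 × Fin 2 × Bool, b ≠ (i, m, n, false) ∧ b ≠ (i, m, n, true) →
      (blockCoord k Yk b • blockBasis k b) i m n = 0 := by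
    rintro ⟨i', m', n', t⟩ ⟨h1, h2⟩
    simp only [blockBasis, Pi.smul_apply, Matrix.smul_apply]
    by_cases hi : i' = i
    · subst hi
      rw [Pi.single_eq_same]
      by_cases hm : m' = m
      · subst hm
        by_cases hn : n' = n
        · subst hn
          cases t
          · exact absurd rfl h1
          · exact absurd rfl h2
        · rw [Matrix.single_apply_of_ne _ _ _ _ _ (by simp [hn]), smul_zero]
      · rw [Matrix.single_apply_of_row_ne hm, smul_zero]
    · rw [Pi.single_eq_of_ne' hi, Matrix.zero_apply, smul_zero]
  rw [Fintype.sum_eq_add (i, m, n, false) (i, m, n, true) (by simp) hkey]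
  simp only [blockBasis, blockCoord, Pi.smul_apply, Matrix.smul_apply, Pi.single_eq_same, Matrix.single_apply_same,
    Bool.false_eq_true, if_false, if_true, Complex.real_smul, mul_one]
  exact (Complex.re_add_im (Yk i m n)).symm

/-- The basis coordinates are bounded by the slot (Frobenius) norms: `|Re∕Im Y_{i,mn}| ≤ ‖Y_{i,mn}‖ ≤ ‖Y_i‖_F`. [folklore] -/
theorem abs_blockCoord_le (k : ℕ) (Yk : Fin k → Matrix (Fin 2) (Fin 2) ℂ) (b : Fin k × Fin 2 × Fin 2 × Bool) :
    |blockCoord k Yk b| ≤ ‖Yk b.1‖ := by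
  -- an entry is bounded by the Frobenius norm (single term of the defining sum)
  have hentry : ∀ (A : Matrix (Fin 2) (Fin 2) ℂ) (m n : Fin 2), ‖A m n‖ ≤ ‖A‖ := by
    intro A m n
    have h : ‖A m n‖₊ ≤ ‖A‖₊ := by
      rw [Matrix.frobenius_nnnorm_def]
      have h1 : ‖A m n‖₊ ^ (2 : ℝ) ≤ ∑ i, ∑ j, ‖A i j‖₊ ^ (2 : ℝ) := by
        have hi : ∑ j, ‖A m j‖₊ ^ (2 : ℝ) ≤ ∑ i, ∑ j, ‖A i j‖₊ ^ (2 : ℝ) :=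
          Finset.single_le_sum (f := fun i => ∑ j, ‖A i j‖₊ ^ (2 : ℝ)) (fun i _ => by positivity) (Finset.mem_univ m)
        exact le_trans (Finset.single_le_sum (f := fun j => ‖A m j‖₊ ^ (2 : ℝ)) (fun j _ => by positivity) (Finset.mem_univ n)) hi
      calc ‖A m n‖₊ = (‖A m n‖₊ ^ (2 : ℝ)) ^ (1 / 2 : ℝ) := by
            rw [← NNReal.rpow_mul]; norm_num
        _ ≤ (∑ i, ∑ j, ‖A i j‖₊ ^ (2 : ℝ)) ^ (1 / 2 : ℝ) := NNReal.rpow_le_rpow h1 (by norm_num)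
    exact_mod_cast h
  unfold blockCoord
  have h := hentry (Yk b.1) b.2.1 b.2.2.1
  split_ifs
  · exact (Complex.abs_im_le_norm _).trans h
  · exact (Complex.abs_re_le_norm _).trans h

/-- The set of blocks with all slots in `SU(2)` is compact (continuous image of the compact group `SU(2)^k`). [folklore] -/
theorem isCompact_unitaryBlocks (k : ℕ) :
    IsCompact {A : Fin k → Matrix (Fin 2) (Fin 2) ℂ | ∀ i, A i ∈ Set.range (fun U : SU2 => (U : Matrix (Fin 2) (Fin 2) ℂ))} := by
  haveI : CompactSpace (Fin k → SU2) := compactSpace_blocksSU2 k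
  have hc : Continuous (fun U : Fin k → SU2 => fun i => (U i : Matrix (Fin 2) (Fin 2) ℂ)) :=
    continuous_pi fun i => continuous_subtype_val.comp (continuous_apply i)
  have heq : {A : Fin k → Matrix (Fin 2) (Fin 2) ℂ | ∀ i, A i ∈ Set.range (fun U : SU2 => (U : Matrix (Fin 2) (Fin 2) ℂ))} =
      Set.range (fun U : Fin k → SU2 => fun i => (U i : Matrix (Fin 2) (Fin 2) ℂ)) := by
    ext A
    constructor
    · intro hA
      choose U hU using hA
      exact ⟨U, funext hU⟩
    · rintro ⟨U, rfl⟩ i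
      exact ⟨U i, rfl⟩
  rw [heq]
  exact isCompact_range hc

/-- ★★ **Uniform bound for third iterated block derivatives of a fixed smooth block function**: there is `C ≥ 0` (depending only on `φ`)
with `|∂^K_{Y¹}∂^K_{Y²}∂^K_{Y³} φ (A)| ≤ C·b₁·b₂·b₃` whenever every slot of `A` is in `SU(2)` and `‖Yⁱ_j‖ ≤ bᵢ` (`bᵢ ≥ 0`) for all slots —
trilinearity in the directions (real-basis expansion) and compactness of `SU(2)^k`. [folklore] -/
theorem exists_bound_frameDK3 {k : ℕ} {φ : (Fin k → Matrix (Fin 2) (Fin 2) ℂ) → ℝ} (hφ : ContDiff ℝ ∞ φ) :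
    ∃ C : ℝ, 0 ≤ C ∧ ∀ (A : Fin k → Matrix (Fin 2) (Fin 2) ℂ),
      (∀ i, A i ∈ Set.range (fun U : SU2 => (U : Matrix (Fin 2) (Fin 2) ℂ))) →
      ∀ (Y₁ Y₂ Y₃ : Fin k → Matrix (Fin 2) (Fin 2) ℂ) (b₁ b₂ b₃ : ℝ), 0 ≤ b₁ → 0 ≤ b₂ → 0 ≤ b₃ →
        (∀ i, ‖Y₁ i‖ ≤ b₁) → (∀ i, ‖Y₂ i‖ ≤ b₂) → (∀ i, ‖Y₃ i‖ ≤ b₃) →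
        |frameDK Y₁ (frameDK Y₂ (frameDK Y₃ φ)) A| ≤ C * b₁ * b₂ * b₃ := by
  classical
  set S := {A : Fin k → Matrix (Fin 2) (Fin 2) ℂ | ∀ i, A i ∈ Set.range (fun U : SU2 => (U : Matrix (Fin 2) (Fin 2) ℂ))} with hS
  have hSc : IsCompact S := isCompact_unitaryBlocks k
  -- the basis triples
  set T : (Fin k × Fin 2 × Fin 2 × Bool) → (Fin k × Fin 2 × Fin 2 × Bool) → (Fin k × Fin 2 × Fin 2 × Bool) →
      (Fin k → Matrix (Fin 2) (Fin 2) ℂ) → ℝ :=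
    fun b₁ b₂ b₃ => frameDK (blockBasis k b₁) (frameDK (blockBasis k b₂) (frameDK (blockBasis k b₃) φ)) with hT
  have hcont : ∀ b₁ b₂ b₃, Continuous (T b₁ b₂ b₃) := fun b₁ b₂ b₃ =>
    (contDiff_frameDK (contDiff_frameDK (contDiff_frameDK hφ _) _) _).continuous
  have hbd : ∀ b₁ b₂ b₃, ∃ Cb : ℝ, ∀ A ∈ S, |T b₁ b₂ b₃ A| ≤ Cb := by
    intro b₁ b₂ b₃
    obtain ⟨Cb, hCb⟩ := hSc.exists_bound_of_continuousOn (hcont b₁ b₂ b₃).continuousOn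
    exact ⟨Cb, fun A hA => by simpa [Real.norm_eq_abs] using hCb A hA⟩
  choose Cb hCb using hbd
  refine ⟨∑ b₁, ∑ b₂, ∑ b₃, |Cb b₁ b₂ b₃|, by positivity, ?_⟩
  intro A hA Y₁ Y₂ Y₃ b₁ b₂ b₃ hb₁ hb₂ hb₃ hY₁ hY₂ hY₃
  have hAS : A ∈ S := hA
  -- expand the three directions in the basis
  rw [blockBasis_expand k Y₁, blockBasis_expand k Y₂, blockBasis_expand k Y₃, frameDK3_sum_smul (blockBasis k) _ _ _ hφ A]
  -- termwise bound
  have hterm : ∀ p₁ p₂ p₃, |blockCoord k Y₁ p₁ * (blockCoord k Y₂ p₂ * (blockCoord k Y₃ p₃ * T p₁ p₂ p₃ A))| ≤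
      (b₁ * b₂ * b₃) * |Cb p₁ p₂ p₃| := by
    intro p₁ p₂ p₃
    have h1 : |blockCoord k Y₁ p₁| ≤ b₁ := (abs_blockCoord_le k Y₁ p₁).trans (hY₁ _)
    have h2 : |blockCoord k Y₂ p₂| ≤ b₂ := (abs_blockCoord_le k Y₂ p₂).trans (hY₂ _)
    have h3 : |blockCoord k Y₃ p₃| ≤ b₃ := (abs_blockCoord_le k Y₃ p₃).trans (hY₃ _)
    have h4 : |T p₁ p₂ p₃ A| ≤ |Cb p₁ p₂ p₃| := (hCb p₁ p₂ p₃ A hAS).trans (le_abs_self _)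
    rw [abs_mul, abs_mul, abs_mul]
    have e : (b₁ * b₂ * b₃) * |Cb p₁ p₂ p₃| = b₁ * (b₂ * (b₃ * |Cb p₁ p₂ p₃|)) := by ring
    rw [e]
    gcongr
  calc |∑ p₁, ∑ p₂, ∑ p₃, blockCoord k Y₁ p₁ * (blockCoord k Y₂ p₂ * (blockCoord k Y₃ p₃ * T p₁ p₂ p₃ A))|
      ≤ ∑ p₁, |∑ p₂, ∑ p₃, blockCoord k Y₁ p₁ * (blockCoord k Y₂ p₂ * (blockCoord k Y₃ p₃ * T p₁ p₂ p₃ A))| :=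
        Finset.abs_sum_le_sum_abs _ _
    _ ≤ ∑ p₁, ∑ p₂, |∑ p₃, blockCoord k Y₁ p₁ * (blockCoord k Y₂ p₂ * (blockCoord k Y₃ p₃ * T p₁ p₂ p₃ A))| :=
        Finset.sum_le_sum fun p₁ _ => Finset.abs_sum_le_sum_abs _ _
    _ ≤ ∑ p₁, ∑ p₂, ∑ p₃, |blockCoord k Y₁ p₁ * (blockCoord k Y₂ p₂ * (blockCoord k Y₃ p₃ * T p₁ p₂ p₃ A))| :=
        Finset.sum_le_sum fun p₁ _ => Finset.sum_le_sum fun p₂ _ => Finset.abs_sum_le_sum_abs _ _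
    _ ≤ ∑ p₁, ∑ p₂, ∑ p₃, (b₁ * b₂ * b₃) * |Cb p₁ p₂ p₃| :=
        Finset.sum_le_sum fun p₁ _ => Finset.sum_le_sum fun p₂ _ => Finset.sum_le_sum fun p₃ _ => hterm p₁ p₂ p₃
    _ = (∑ p₁, ∑ p₂, ∑ p₃, |Cb p₁ p₂ p₃|) * b₁ * b₂ * b₃ := by
        simp only [← Finset.mul_sum]
        ring

end Summit.QuantumFields.YangMills.Theorems.VirialFluxGap.FrameHessian

end
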